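import Summits.AnomalousDissipation.AnomalousDissipation.Theses.MirrorEnsemble
import Summits.AnomalousDissipation.AnomalousDissipation.Theorems.TaylorGreenLoudGalerkinStates.Negative.Anatomy
import Summits.AnomalousDissipation.AnomalousDissipation.Theorems.MirrorVarietySteadyWeakIsGlobalLerayHopf
import Mathlib.Analysis.SpecialFunctions.Complex.Circle

/-!
# Sketch — crux-ideate stmt-AnomalousDissipation-17694 (B_K = `MirrorEnsemble.MirrorMeanBoundedFamilyTG`), ideator k = 2, round 1

First lemmas of the two idea cards (statements must elaborate; the two transfer directions are PROVED):

* card `full-tg-group` — enlarge the mirror class `Fix K` to the FULL Taylor–Green class `Fix K_D`,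
  `D` = the three half-period translations `(½,0,½), (0,½,½), (½,½,0)`:
  `IsDSymmLift`, `MirrorMeanBoundedFamilyTGFull` (= B_{K_D}), `crux_of_full : B_{K_D} → B_K` (proved),
  `TgForceHalfShiftInvariant` (f_TG ∈ Fix D), `DInvariantFourierSupport` (Fix D = BCC Fourier support:
  k₀ ≡ k₁ ≡ k₂ mod 2), `GravestShellPoincare` (in Fix K_D the forcing shell |k|² = 3 is the gravest shell:
  ‖∇v‖² ≥ 12π² ‖v‖²).
* card `quiet-steady-saddle` — B_K (alone among the arena's open items) admits QUIET witnesses: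
  `SteadyMirrorBranchTG` (= C⁺: a bounded, possibly quiet, possibly unstable branch of steady weak K-states
  along ν_j → 0) and `crux_of_steadyBranch : C⁺ → B_K` (proved from the landed `isGlobalLerayHopf_steady`
  and `meanEnergy_eq_of_periodic`).
-/

set_option linter.dupNamespace false

noncomputable section

open MeasureTheory Filter Topology Set Function UnitAddTorus
open scoped InnerProductSpace ENNReal
open Literature.Analysis.FunctionSpaces Literature.Analysis.FunctionSpaces.Torus
open Literature.Analysis.FluidPDE Literature.Analysis.FluidPDE.Torus

namespace Summit.AnomalousDissipation.AnomalousDissipation.Cruxes.MirrorMeanBoundedFamilyTG.Ideator2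

open Summit.AnomalousDissipation.AnomalousDissipation.Theorems
open Summit.AnomalousDissipation.AnomalousDissipation.Theorems.TaylorGreenLoudGalerkinStates.Negative

/-- The crux B_K by its route name. -/
abbrev B : Prop := Summit.AnomalousDissipation.AnomalousDissipation.Theses.MirrorEnsemble.MirrorMeanBoundedFamilyTG

/-- The pinned Taylor–Green lambda of the route decls is `Negative.tgForce` (definitional). -/
theorem tgForce_eq' : tgForce = (fun x : UnitAddTorus (Fin 3) => !₂[(fourier 1 (x 0) : ℂ).im * (fourier 1 (x 1) : ℂ).re * (fourier 1 (x 2) : ℂ).re, -((fourier 1 (x 0) : ℂ).re * (fourier 1 (x 1) : ℂ).im * (fourier 1 (x 2) : ℂ).re), (0 : ℝ)]) :=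
  rfl

/-! ## Shared vocabulary (as in the strategist's CensusSketch) -/

/-- The `H`-lift clause for one path. -/
def IsLift (u : ℝ → UnitAddTorus (Fin 3) → EuclideanSpace ℝ (Fin 3)) (U : ℝ → energySpace (Fin 3)) : Prop :=
  ∀ t, 0 ≤ t → ((U t : Lp (EuclideanSpace ℝ (Fin 3)) 2 (volume : Measure (UnitAddTorus (Fin 3)))) :
    UnitAddTorus (Fin 3) → EuclideanSpace ℝ (Fin 3)) =ᵐ[volume] u t

/-- The coordinatewise `K`-symmetry clause of the lift (a.e., every `t ≥ 0`) — verbatim the route's clause. -/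
def IsKSymmLift (U : ℝ → energySpace (Fin 3)) : Prop :=
  ∀ t, 0 ≤ t → ∀ i i' : Fin 3, (fun x => ((U t : Lp (EuclideanSpace ℝ (Fin 3)) 2 (volume : Measure (UnitAddTorus (Fin 3)))) :
      UnitAddTorus (Fin 3) → EuclideanSpace ℝ (Fin 3)) (Function.update x i (-x i)) i') =ᵐ[volume]
    (fun x => if i' = i then -(((U t : Lp (EuclideanSpace ℝ (Fin 3)) 2 (volume : Measure (UnitAddTorus (Fin 3)))) :
      UnitAddTorus (Fin 3) → EuclideanSpace ℝ (Fin 3)) x i') else ((U t : Lp (EuclideanSpace ℝ (Fin 3)) 2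
        (volume : Measure (UnitAddTorus (Fin 3)))) : UnitAddTorus (Fin 3) → EuclideanSpace ℝ (Fin 3)) x i')

/-! ## Card `full-tg-group`: the full Taylor–Green class `Fix K_D` -/

/-- The half-period translation vector `e_i/2 + e_j/2` of `T³ = (ℝ/ℤ)³`. For `(i,j) ∈ {(0,2),(1,2),(0,1)}` these are
the three non-trivial elements of the Klein group `D` under which `f_TG` is invariant. -/
def halfShift (i j : Fin 3) : UnitAddTorus (Fin 3) := fun l => if l = i ∨ l = j then ((2⁻¹ : ℝ) : UnitAddCircle) else 0

/-- **First lemma (a) (PROVED below, `tgForce_halfShift_invariant`):** `f_TG ∈ Fix D` — the Taylor–Green force is invariant under the three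
half-period translations (each flips the sign of exactly two of the factors `sin 2πx₀`, `cos 2πx₁`, `cos 2πx₂`;
Fourier side: `f̂_TG` lives on the all-odd shell `{±1}³`, `mFourierCoeff_tgForce`). -/
def TgForceHalfShiftInvariant : Prop :=
  ∀ x : UnitAddTorus (Fin 3), tgForce (x + halfShift 0 2) = tgForce x ∧ tgForce (x + halfShift 1 2) = tgForce x ∧
    tgForce (x + halfShift 0 1) = tgForce x

/-- Half a period flips the sign of the basic character: `e(t + ½) = −e(t)` on `ℝ/ℤ`. [folklore] -/
theorem fourier_one_add_half (t : UnitAddCircle) :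
    (fourier 1 (t + ((2⁻¹ : ℝ) : UnitAddCircle)) : ℂ) = - fourier 1 t := by
  rw [fourier_apply, fourier_apply, one_zsmul, one_zsmul, AddCircle.toCircle_add]
  push_cast
  have h : ((AddCircle.toCircle ((2⁻¹ : ℝ) : UnitAddCircle)) : ℂ) = -1 := by
    rw [AddCircle.toCircle_apply_mk]
    push_cast
    have : (2 * (Real.pi : ℂ) / 1 * 2⁻¹ * Complex.I) = Real.pi * Complex.I := by ring
    rw [this]
    exact Complex.exp_pi_mul_I
  rw [h]; ring

/-- **First lemma (a), PROVED**: `f_TG` is invariant under the three half-period translations (`f_TG ∈ Fix D`). -/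
theorem tgForce_halfShift_invariant : TgForceHalfShiftInvariant := by
  intro x
  refine ⟨?_, ?_, ?_⟩
  · have e0 : (x + halfShift 0 2) 0 = x 0 + ((2⁻¹ : ℝ) : UnitAddCircle) := by simp [halfShift]
    have e1 : (x + halfShift 0 2) 1 = x 1 := by simp [halfShift]
    have e2 : (x + halfShift 0 2) 2 = x 2 + ((2⁻¹ : ℝ) : UnitAddCircle) := by simp [halfShift]
    simp only [tgForce, e0, e1, e2, fourier_one_add_half, Complex.neg_re, Complex.neg_im]
    congr 1
    ext i
    fin_cases i <;> simp <;> ring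
  · have e0 : (x + halfShift 1 2) 0 = x 0 := by simp [halfShift]
    have e1 : (x + halfShift 1 2) 1 = x 1 + ((2⁻¹ : ℝ) : UnitAddCircle) := by simp [halfShift]
    have e2 : (x + halfShift 1 2) 2 = x 2 + ((2⁻¹ : ℝ) : UnitAddCircle) := by simp [halfShift]
    simp only [tgForce, e0, e1, e2, fourier_one_add_half, Complex.neg_re, Complex.neg_im]
    congr 1
    ext i
    fin_cases i <;> simp <;> ring
  · have e0 : (x + halfShift 0 1) 0 = x 0 + ((2⁻¹ : ℝ) : UnitAddCircle) := by simp [halfShift]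
    have e1 : (x + halfShift 0 1) 1 = x 1 + ((2⁻¹ : ℝ) : UnitAddCircle) := by simp [halfShift]
    have e2 : (x + halfShift 0 1) 2 = x 2 := by simp [halfShift]
    simp only [tgForce, e0, e1, e2, fourier_one_add_half, Complex.neg_re, Complex.neg_im]
    congr 1
    ext i
    fin_cases i <;> simp <;> ring

/-- The `D`-symmetry clause of a lift: a.e. invariance under the three half-period translations, every `t ≥ 0`. -/
def IsDSymmLift (U : ℝ → energySpace (Fin 3)) : Prop :=
  ∀ t, 0 ≤ t → ∀ i j : Fin 3, i ≠ j →
    (fun x => ((U t : Lp (EuclideanSpace ℝ (Fin 3)) 2 (volume : Measure (UnitAddTorus (Fin 3)))) :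
      UnitAddTorus (Fin 3) → EuclideanSpace ℝ (Fin 3)) (x + halfShift i j)) =ᵐ[volume]
    (fun x => ((U t : Lp (EuclideanSpace ℝ (Fin 3)) 2 (volume : Measure (UnitAddTorus (Fin 3)))) :
      UnitAddTorus (Fin 3) → EuclideanSpace ℝ (Fin 3)) x)

/-- **B_{K_D}** — the crux restricted to the FULL Taylor–Green class: some Leray–Hopf family of NS_{ν_j}(f_TG),
`ν_j → 0`, whose `H`-lifts are `K`-symmetric AND `D`-symmetric a.e., has ν-uniformly bounded limsup-mean energy. -/
def MirrorMeanBoundedFamilyTGFull : Prop :=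
  ∀ f : UnitAddTorus (Fin 3) → EuclideanSpace ℝ (Fin 3), f = (fun x => !₂[(fourier 1 (x 0) : ℂ).im * (fourier 1 (x 1) : ℂ).re * (fourier 1 (x 2) : ℂ).re, -((fourier 1 (x 0) : ℂ).re * (fourier 1 (x 1) : ℂ).im * (fourier 1 (x 2) : ℂ).re), (0 : ℝ)]) →
    ∃ (E : ℝ) (ν : ℕ → ℝ) (u₀ : ℕ → UnitAddTorus (Fin 3) → EuclideanSpace ℝ (Fin 3))
      (u : ℕ → ℝ → UnitAddTorus (Fin 3) → EuclideanSpace ℝ (Fin 3)) (U : ℕ → ℝ → energySpace (Fin 3)),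
      (∀ j, 0 < ν j) ∧ Tendsto ν atTop (nhds 0) ∧ (∀ j, IsGlobalLerayHopf (ν j) (fun _ => f) (u₀ j) (u j)) ∧
        (∀ j, IsLift (u j) (U j)) ∧ (∀ j, IsKSymmLift (U j)) ∧ (∀ j, IsDSymmLift (U j)) ∧
          ∀ j, meanEnergy (u j) ≤ E

/-- **Transfer, PROVED: `B_{K_D} → B_K`** (a `K_D`-symmetric family is a `K`-symmetric family: forget the `D` clause). -/
theorem crux_of_full (h : MirrorMeanBoundedFamilyTGFull) : B := by
  intro f hf
  obtain ⟨E, ν, u₀, u, U, hν, hν0, hLH, hl, hK, -, hE⟩ := h f hf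
  exact ⟨E, ν, u₀, u, U, hν, hν0, hLH, hl, hK, hE⟩

/-- **First lemma (b), provable now (M): the Fourier support of `Fix D` is the body-centred sublattice.**
An `L²` field invariant a.e. under the half-period translations `(½,0,½)` and `(0,½,½)` has
`mFourierCoeff = 0` at every frequency whose three components are not all of the same parity
(translation by `d` multiplies `v̂(k)` by `e^{2πi k·d} = (−1)^{k_i + k_j}`).  Consequences recorded on the card:
the `K_D`-shells `|k|² ∈ {1, 2, 5, 6, 9, 10}` are EMPTY, the planar Taylor–Green cells (`|k|² = 2`) are excluded,
and the forcing shell `|k|² = 3` is the gravest non-empty shell. -/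
def DInvariantFourierSupport : Prop :=
  ∀ v : UnitAddTorus (Fin 3) → EuclideanSpace ℝ (Fin 3), MemLp v 2 volume →
    (fun x => v (x + halfShift 0 2)) =ᵐ[volume] v → (fun x => v (x + halfShift 1 2)) =ᵐ[volume] v →
      ∀ k : Fin 3 → ℤ, ¬ (k 0 ≡ k 1 [ZMOD 2] ∧ k 1 ≡ k 2 [ZMOD 2]) →
        mFourierCoeff (EuclideanSpace.complexify ∘ v) k = 0

/-- **First lemma (c), provable now (M): gravest-shell Poincaré inequality in `Fix K_D`.**
For a smooth mean-zero `D`-invariant field every non-zero Fourier mode is body-centred, and the shortest non-zero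
body-centred vectors are `(±1,±1,±1)` (`|k|² = 3`; the all-even ones start at `|k|² = 4`), hence
`‖∇v‖²_{L²} ≥ 3·(2π)² ‖v‖²_{L²} = 12π² ‖v‖²` (K-symmetry is not even needed): the Stokes eigenvalue of the FORCING
shell is the bottom of the spectrum of `Fix K_D`, `(f_TG, −Δv) = 12π² (f_TG, v)`, and the forcing drops out of the
excess-enstrophy budget `d/dt(‖∇u‖² − 12π²‖u‖²) = −2ν(‖Δu‖² − 12π²‖∇u‖²) + 2∫ω·Sω`. -/
def GravestShellPoincare : Prop :=
  ∀ v : UnitAddTorus (Fin 3) → EuclideanSpace ℝ (Fin 3), IsSmooth v → IsDivFree v → HasZeroMean v →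
    (∀ x, v (x + halfShift 0 2) = v x) → (∀ x, v (x + halfShift 1 2) = v x) →
      12 * Real.pi ^ 2 * ∫ x, ‖v x‖ ^ 2 ≤ gradNormSq v

/-! ## Card `quiet-steady-saddle`: B_K admits quiet / unstable steady witnesses -/

/-- The mirror set in `H`: coordinatewise `K`-symmetric fields (a.e.). -/
def mirrorSet : Set (energySpace (Fin 3)) :=
  {v | ∀ i i' : Fin 3, (fun x => ((v : Lp (EuclideanSpace ℝ (Fin 3)) 2 (volume : Measure (UnitAddTorus (Fin 3)))) :
      UnitAddTorus (Fin 3) → EuclideanSpace ℝ (Fin 3)) (Function.update x i (-x i)) i') =ᵐ[volume]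
    (fun x => if i' = i then -(((v : Lp (EuclideanSpace ℝ (Fin 3)) 2 (volume : Measure (UnitAddTorus (Fin 3)))) :
      UnitAddTorus (Fin 3) → EuclideanSpace ℝ (Fin 3)) x i') else ((v : Lp (EuclideanSpace ℝ (Fin 3)) 2
        (volume : Measure (UnitAddTorus (Fin 3)))) : UnitAddTorus (Fin 3) → EuclideanSpace ℝ (Fin 3)) x i')}

/-- **C⁺ (transfer target of card `quiet-steady-saddle`)**: a BOUNDED BRANCH OF STEADY MIRROR STATES — along some
`ν_j → 0⁺` there are steady weak solutions `v_j ∈ V ∩ Fix K` of NS_{ν_j}(f_TG) with the energy equation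
`ν_j ‖∇v_j‖² = (v_j, f_TG)` and `∫|v_j|² ≤ E`.  No loudness, no stability, no non-degeneracy is asked: quiet
(`ν_j‖∇v_j‖² → 0`) and dynamically unstable (saddle) states qualify. -/
def SteadyMirrorBranchTG : Prop :=
  ∃ (E : ℝ) (ν : ℕ → ℝ) (v : ℕ → energySpace (Fin 3)),
    (∀ j, 0 < ν j) ∧ Tendsto ν atTop (nhds 0) ∧
      ∀ j, ((v j : Lp (EuclideanSpace ℝ (Fin 3)) 2 (volume : Measure (UnitAddTorus (Fin 3)))) ∈ energySpaceV (Fin 3)) ∧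
        IsSteadyWeakSolution (ν j) tgForce (v j) ∧
        (ν j * (eGradNormSq ((v j : Lp (EuclideanSpace ℝ (Fin 3)) 2 (volume : Measure (UnitAddTorus (Fin 3)))) :
            UnitAddTorus (Fin 3) → EuclideanSpace ℝ (Fin 3))).toReal =
          pairing (v j : Lp (EuclideanSpace ℝ (Fin 3)) 2 (volume : Measure (UnitAddTorus (Fin 3)))) tgForce) ∧
        v j ∈ mirrorSet ∧
        ∫ x, ‖((v j : Lp (EuclideanSpace ℝ (Fin 3)) 2 (volume : Measure (UnitAddTorus (Fin 3)))) :
            UnitAddTorus (Fin 3) → EuclideanSpace ℝ (Fin 3)) x‖ ^ 2 ≤ E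

/-- **Transfer, PROVED: `C⁺ → B_K`.**  The constant path at a steady weak `K`-state is a global Leray–Hopf solution
from its own datum with limsup-mean energy `∫|v_j|²` (`steadyWeakIsGlobalLerayHopf_proof`, landed for MirrorVariety:
`isGlobalLerayHopf_steady` + `meanEnergy_eq_of_periodic`), and its lift is the constant `H`-path, so the mirror clause
is the membership `v_j ∈ mirrorSet`. -/
theorem crux_of_steadyBranch (h : SteadyMirrorBranchTG) : B := by
  intro f hf
  have hfg : f = tgForce := hf.trans tgForce_eq'.symm
  subst hfg
  obtain ⟨E, ν, v, hν, hν0, hall⟩ := h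
  refine ⟨E, ν, fun j => ((v j : Lp (EuclideanSpace ℝ (Fin 3)) 2 (volume : Measure (UnitAddTorus (Fin 3)))) :
      UnitAddTorus (Fin 3) → EuclideanSpace ℝ (Fin 3)),
    fun j _ => ((v j : Lp (EuclideanSpace ℝ (Fin 3)) 2 (volume : Measure (UnitAddTorus (Fin 3)))) :
      UnitAddTorus (Fin 3) → EuclideanSpace ℝ (Fin 3)), fun j _ => v j, hν, hν0, ?_, ?_, ?_, ?_⟩
  · intro j
    obtain ⟨hV, hsol, heq, -, -⟩ := hall j
    exact (steadyWeakIsGlobalLerayHopf_proof (ν j) tgForce (v j) (hν j) isSmooth_tgForce hasZeroMean_tgForce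
      hV hsol heq).1
  · intro j t _
    exact Filter.EventuallyEq.rfl
  · intro j t _ i i'
    obtain ⟨-, -, -, hK, -⟩ := hall j
    exact hK i i'
  · intro j
    obtain ⟨hV, hsol, heq, -, hE⟩ := hall j
    rw [(steadyWeakIsGlobalLerayHopf_proof (ν j) tgForce (v j) (hν j) isSmooth_tgForce hasZeroMean_tgForce
      hV hsol heq).2.1]
    exact hE

/-- The planar Taylor–Green cell force on the pumped face `{x₂ = 0}` (coordinates `y = (x₀, x₁)`):
`g(y) = (sin 2πy₀ cos 2πy₁, −cos 2πy₀ sin 2πy₁)`, the trace of `f_TG` on that face. -/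
def faceCellForce (y : EuclideanSpace ℝ (Fin 2)) : EuclideanSpace ℝ (Fin 2) :=
  !₂[Real.sin (2 * Real.pi * y 0) * Real.cos (2 * Real.pi * y 1), -(Real.cos (2 * Real.pi * y 0) * Real.sin (2 * Real.pi * y 1))]

/-- The closed pumped face `F̄ = [0, ½]²` of the Taylor–Green box. -/
def closedFace : Set (EuclideanSpace ℝ (Fin 2)) := {y | ∀ i, y i ∈ Set.Icc (0 : ℝ) 2⁻¹}

/-- **First NEW lemma of card `quiet-saddle-branch` (provable now, M): the FACE-TRACE KELVIN OBSTRUCTION.**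
No `C¹` planar field `V` tangent to the boundary of the pumped face, together with a `C¹` pressure `P`, can satisfy
the tangential steady Euler balance `(V·∇)V + ∇P = g` on the closed face: integrating the 2-D identity
`curl((V·∇)V) = div(ζ V)` (`ζ = curl V`) over the face gives `0` (tangency), `curl ∇P` integrates to `0`, while
`∫_F curl g = ∮_{∂F} g·dl = 4·(1/π) ≠ 0` (the Kelvin pump of PumpedMirror, moved from the edge loop to the face
by Stokes).  Consequence used by the card: a bounded steady `K`-branch cannot converge in `C¹` up to a pumped face
to a forced-Euler flow — friction stays `O(1)` on the faces and the inviscid core is not `C¹` there.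
(Stated with global `C¹` hypotheses for the sketch; the line wants the `C¹(F̄)` version.) -/
def FaceTraceObstructionTG : Prop :=
  ∀ (V : EuclideanSpace ℝ (Fin 2) → EuclideanSpace ℝ (Fin 2)) (P : EuclideanSpace ℝ (Fin 2) → ℝ),
    ContDiff ℝ 1 V → ContDiff ℝ 1 P →
    (∀ y ∈ closedFace, (y 0 = 0 ∨ y 0 = 2⁻¹) → V y 0 = 0) →
    (∀ y ∈ closedFace, (y 1 = 0 ∨ y 1 = 2⁻¹) → V y 1 = 0) →
    (∀ y ∈ closedFace, ∀ i : Fin 2,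
      (fderiv ℝ V y (V y)) i + fderiv ℝ P y (EuclideanSpace.single i (1 : ℝ)) = faceCellForce y i) →
    False

end Summit.AnomalousDissipation.AnomalousDissipation.Cruxes.MirrorMeanBoundedFamilyTG.Ideator2

end
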